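import Summits.NavierStokesRegularity.FluidComputer.PalasekTowerTinyBlobCalculus
import Summits.NavierStokesRegularity.FluidComputer.PalasekTowerTinyBlobLoop
import Summits.NavierStokesRegularity.FluidComputer.PalasekTowerGermHostPushed
import Summits.NavierStokesRegularity.FluidComputer.PalasekTowerGermEvenProfile
import Summits.NavierStokesRegularity.FluidComputer.PalasekTowerRegisterGlobalSmallData

/-!
# The tiny blob, V: tiny anchored level-`0` hosts (`TinyAnchoredHosts` holds)

Cell `ns-blowup`, seat `ns-blowup-ecbridge-4` (g3); GROUP C «BRIDGE SUPPORT» of the route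
`PalasekTowerBreakdown` (crux `EpisodeBaseG`, item stmt-NavierStokesRegularity-19179). LABEL: E–C
typing (KERNEL construction; everything proved). WHAT THIS IS NOT: not Navier–Stokes evidence and
not a statement about NS dynamics — it exhibits, for every `δ > 0`, a PRESCRIBED level-`0` host of
register v2.3′ (pins, rigid, quiet, global route-G margins) whose schedule radius is `≤ δ` and whose
datum at `τ₀` is compactly supported with `‖u(τ₀)‖_{L³} ≤ δ`: the hypothesis `TinyAnchoredHosts` of
the negative lemma `EpisodeBaseNegative.firstEpisodeR_false_of_engine_of_tinyHosts`.

The profile is `U_a = Y₀ • B_a` (`B_a` the tiny blob of `PalasekTowerTinyBlob`), radius `ρ = 2a`: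
* §1 scaling `B_a(y) = B_1(y/a)`, `DB_a(y) = a⁻¹ DB_1(y/a)`; a strain point with
  `‖DU_a‖ = Y₀ κ₁/a ≥ A₀ = N₀Y₀` once `a ≤ κ₁/N₀` (`κ₁ > 0` the norm of `DB_1` at a fixed point);
* §2 the weak slot `Germ.LevelZeroDataWeak U_a (2a)` for `0 < a ≤ min (5/256) (κ₁/256)`: ceiling
  `‖U_a‖ ≤ Y₀` with equality exactly at `0`; WEAK ANCHOR from flatness + evenness
  (`Germ.inner_accel_nonneg_of_even_flat`: `accel 1 U_a 0 = 0`); core loop = the `m`-fold tiny loop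
  with `m = ⌈1/(64a)⌉`: radius `a/5 ≤ 1/N₀`, speed `2πm a/5 ≤ 8π/N₀`, circulation
  `≥ Y₀ (7/20) a m ≥ 7Y₀/1280 ≥ Y₀/N₀ = N₀^{β−2}`;
* §3 `‖U_a‖_{L³} ≤ Y₀ (8a³ |B̄₁|)^{1/3} → 0`; **`tinyAnchoredHosts_holds : TinyAnchoredHosts`** via
  `Germ.LevelZeroDataWeak.exists_host` (the pushed germ host of GermHostPushed).

References: S. Palasek, arXiv:2605.13827 §3.3 [cite: Palasek2026ElementaryModel, §3.3]; the
small-data side is T. Kato, Math. Z. 187 (1984) 471–480 [cite: Kato1984, Thm. 2] (only motivating the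
lane; not used here).
-/

noncomputable section

namespace Summit.NavierStokesRegularity.FluidComputer.PalasekTowerClayBridge.TinyBlob

open Real Set Function Filter Topology InnerProductSpace Metric MeasureTheory
open scoped Topology ContDiff RealInnerProductSpace ENNReal Laplacian

open Literature.Analysis.FluidPDE

variable {a : ℝ}

/-! ## §1 Scaling and the strain point -/

/-- **Scaling**: `B_a(y) = B_1(a⁻¹ y)`. [folklore] -/
theorem tinyBlob_eq_one_inv_smul (ha : a ≠ 0) (y : EuclideanSpace ℝ (Fin 3)) :
    tinyBlob a y = tinyBlob 1 (a⁻¹ • y) := by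
  have hn : ‖a⁻¹ • y‖ ^ 2 / (1 : ℝ) ^ 2 = ‖y‖ ^ 2 / a ^ 2 := by
    rw [norm_smul, norm_inv, Real.norm_eq_abs, mul_pow, inv_pow, sq_abs]; field_simp
  rw [tinyBlob, tinyBlob, hn, smul_smul]
  simp only [PiLp.smul_apply, smul_eq_mul]
  congr 2
  field_simp

/-- **Scaling of the Jacobian**: `DB_a(y) = a⁻¹ • DB_1(a⁻¹ y)`. [folklore] -/
theorem fderiv_tinyBlob_eq_inv_smul (ha : a ≠ 0) (y : EuclideanSpace ℝ (Fin 3)) :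
    fderiv ℝ (tinyBlob a) y = a⁻¹ • fderiv ℝ (tinyBlob 1) (a⁻¹ • y) := by
  have hfun : tinyBlob a = tinyBlob 1 ∘ fun y : EuclideanSpace ℝ (Fin 3) => a⁻¹ • y := by
    funext z; exact tinyBlob_eq_one_inv_smul ha z
  have h1 : HasFDerivAt (fun y : EuclideanSpace ℝ (Fin 3) => a⁻¹ • y)
      (a⁻¹ • ContinuousLinearMap.id ℝ (EuclideanSpace ℝ (Fin 3))) y :=
    (hasFDerivAt_id y).const_smul a⁻¹
  have h2 := ((differentiable_tinyBlob 1) (a⁻¹ • y)).hasFDerivAt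
  rw [hfun, (h2.comp y h1).fderiv, ContinuousLinearMap.comp_smul, ContinuousLinearMap.comp_id]

/-- A point where `DB_1 ≠ 0`, inside `B̄(0, 2)`. [folklore] -/
theorem exists_strainPt : ∃ y : EuclideanSpace ℝ (Fin 3), ‖y‖ ≤ 2 ∧ fderiv ℝ (tinyBlob 1) y ≠ 0 := by
  obtain ⟨y, hy, h⟩ := exists_fderiv_tinyBlob_ne_zero (a := 1) one_pos
  exact ⟨y, by simpa using hy, h⟩

/-- The strain point of `B_1`. [folklore] -/
def strainPt : EuclideanSpace ℝ (Fin 3) := exists_strainPt.choose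

/-- `‖y₁‖ ≤ 2`. [folklore] -/
theorem norm_strainPt_le : ‖strainPt‖ ≤ 2 := exists_strainPt.choose_spec.1

/-- The strain constant `κ₁ = ‖DB_1(y₁)‖`. [folklore] -/
def strainConst : ℝ := ‖fderiv ℝ (tinyBlob 1) strainPt‖

/-- `0 < κ₁`. [folklore] -/
theorem strainConst_pos : 0 < strainConst := norm_pos_iff.2 exists_strainPt.choose_spec.2

/-- `‖DB_a(a y₁)‖ = κ₁ / a`. [folklore] -/
theorem norm_fderiv_tinyBlob_strainPt (ha : 0 < a) :
    ‖fderiv ℝ (tinyBlob a) (a • strainPt)‖ = strainConst / a := by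
  rw [fderiv_tinyBlob_eq_inv_smul ha.ne', smul_smul, inv_mul_cancel₀ ha.ne', one_smul, norm_smul,
    norm_inv, Real.norm_eq_abs, abs_of_pos ha, strainConst, div_eq_inv_mul]

/-! ## §2 The tiny host profile and its weak slot -/

/-- **The tiny host profile** `U_a = Y₀ • B_a`. [folklore] -/
def tinyProfile (a : ℝ) (y : EuclideanSpace ℝ (Fin 3)) : EuclideanSpace ℝ (Fin 3) :=
  TowerRates.wide.Y 0 • tinyBlob a y

/-- `U_a` is smooth. [folklore] -/
theorem contDiff_tinyProfile (a : ℝ) : ContDiff ℝ ∞ (tinyProfile a) := by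
  show ContDiff ℝ ∞ (fun y => TowerRates.wide.Y 0 • tinyBlob a y)
  exact (contDiff_const (c := TowerRates.wide.Y 0)).smul (contDiff_tinyBlob a)

/-- `U_a` vanishes outside `B̄(0, 2a)`. [folklore] -/
theorem tinyProfile_eq_zero_of_norm_gt (ha : 0 < a) {y : EuclideanSpace ℝ (Fin 3)}
    (hy : 2 * a < ‖y‖) : tinyProfile a y = 0 := by
  rw [tinyProfile, tinyBlob_eq_zero_of_norm_gt ha hy, smul_zero]

/-- `tsupport U_a ⊆ B̄(0, 2a)`. [folklore] -/
theorem tsupport_tinyProfile_subset (ha : 0 < a) :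
    tsupport (tinyProfile a) ⊆ closedBall (0 : EuclideanSpace ℝ (Fin 3)) (2 * a) :=
  (tsupport_smul_subset_right (fun _ => TowerRates.wide.Y 0) (tinyBlob a)).trans
    (tsupport_tinyBlob_subset ha)

/-- `U_a` has compact support. [folklore] -/
theorem hasCompactSupport_tinyProfile (ha : 0 < a) : HasCompactSupport (tinyProfile a) :=
  (isCompact_closedBall (0 : EuclideanSpace ℝ (Fin 3)) (2 * a)).of_isClosed_subset
    (isClosed_tsupport _) (tsupport_tinyProfile_subset ha)

/-- `U_a` is divergence free. [folklore] -/
theorem isDivFree_tinyProfile (ha : a ≠ 0) : VectorCalculus.IsDivFree (tinyProfile a) := by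
  intro y
  show VectorCalculus.divergence (fun z => TowerRates.wide.Y 0 • tinyBlob a z) y = 0
  rw [divergence_const_smul_apply ((differentiable_tinyBlob a) y), isDivFree_tinyBlob ha y, mul_zero]

/-- `‖U_a(y)‖ = Y₀ ‖B_a(y)‖`. [folklore] -/
theorem norm_tinyProfile (a : ℝ) (y : EuclideanSpace ℝ (Fin 3)) :
    ‖tinyProfile a y‖ = TowerRates.wide.Y 0 * ‖tinyBlob a y‖ := by
  rw [tinyProfile, norm_smul, Real.norm_eq_abs, abs_of_pos (TowerRates.Y_pos _ _)]

/-- Ceiling `‖U_a‖ ≤ Y₀`. [folklore] -/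
theorem norm_tinyProfile_le (ha : a ≠ 0) (y : EuclideanSpace ℝ (Fin 3)) :
    ‖tinyProfile a y‖ ≤ TowerRates.wide.Y 0 := by
  rw [norm_tinyProfile]
  have hY := TowerRates.Y_pos TowerRates.wide 0
  nlinarith [norm_tinyBlob_le_one ha y]

/-- `‖U_a(0)‖ = Y₀`. [folklore] -/
theorem norm_tinyProfile_zero (a : ℝ) : ‖tinyProfile a 0‖ = TowerRates.wide.Y 0 := by
  rw [norm_tinyProfile, norm_tinyBlob_zero, mul_one]

/-- The speed maximum is attained only at the centre. [folklore] -/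
theorem eq_zero_of_norm_tinyProfile_eq (ha : a ≠ 0) {y : EuclideanSpace ℝ (Fin 3)}
    (hy : ‖tinyProfile a y‖ = TowerRates.wide.Y 0) : y = 0 := by
  rw [norm_tinyProfile] at hy
  have hY := TowerRates.Y_pos TowerRates.wide 0
  have h1 : ‖tinyBlob a y‖ = 1 := by
    have := mul_left_cancel₀ hY.ne' (hy.trans (mul_one _).symm)
    exact this
  exact (norm_tinyBlob_eq_one_iff ha).1 h1

/-- `U_a` is even. [folklore] -/
theorem tinyProfile_neg (a : ℝ) (y : EuclideanSpace ℝ (Fin 3)) :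
    tinyProfile a (-y) = tinyProfile a y := by
  rw [tinyProfile, tinyProfile, tinyBlob_neg]

/-- `DU_a = Y₀ • DB_a`. [folklore] -/
theorem fderiv_tinyProfile (a : ℝ) (y : EuclideanSpace ℝ (Fin 3)) :
    fderiv ℝ (tinyProfile a) y = TowerRates.wide.Y 0 • fderiv ℝ (tinyBlob a) y := by
  show fderiv ℝ (fun z => TowerRates.wide.Y 0 • tinyBlob a z) y = _
  rw [fderiv_fun_const_smul ((differentiable_tinyBlob a) y)]

/-- `DU_a(0) = 0`. [folklore] -/
theorem fderiv_tinyProfile_zero (a : ℝ) : fderiv ℝ (tinyProfile a) 0 = 0 := by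
  rw [fderiv_tinyProfile, fderiv_tinyBlob_zero]
  ext v i
  simp

/-- `ΔU_a(0) = 0`. [folklore] -/
theorem laplacian_tinyProfile_zero (a : ℝ) : (Δ (tinyProfile a)) 0 = 0 := by
  have hfun : tinyProfile a = TowerRates.wide.Y 0 • tinyBlob a := rfl
  have h2 : ContDiffAt ℝ 2 (tinyBlob a) 0 := ((contDiff_tinyBlob a).of_le (by norm_cast)).contDiffAt
  rw [hfun, laplacian_smul _ h2, laplacian_tinyBlob_zero, smul_zero]

/-- **The weak anchor** of the tiny profile. [folklore] -/
theorem anchor_tinyProfile (ha : 0 < a) (y : EuclideanSpace ℝ (Fin 3))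
    (hy : ‖tinyProfile a y‖ = TowerRates.wide.Y 0) :
    0 ≤ ⟪tinyProfile a y, Germ.accel 1 (tinyProfile a) y⟫ := by
  obtain rfl := eq_zero_of_norm_tinyProfile_eq ha.ne' hy
  exact Germ.inner_accel_nonneg_of_even_flat (contDiff_tinyProfile a) (hasCompactSupport_tinyProfile ha)
    (isDivFree_tinyProfile ha.ne') (tinyProfile_neg a) (fderiv_tinyProfile_zero a)
    (laplacian_tinyProfile_zero a)

/-- **The strain floor**: `A₀ ≤ ‖DU_a(a y₁)‖` once `a ≤ κ₁/256`. [folklore] -/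
theorem strain_tinyProfile (ha : 0 < a) (hκ : a ≤ strainConst / 256) :
    TowerRates.wide.A 0 ≤ ‖fderiv ℝ (tinyProfile a) (a • strainPt)‖ := by
  rw [fderiv_tinyProfile, norm_smul, Real.norm_eq_abs, abs_of_pos (TowerRates.Y_pos _ _),
    norm_fderiv_tinyBlob_strainPt ha, Host.wide_A_zero_eq, Host.wide_N_zero, mul_comm]
  have hY := TowerRates.Y_pos TowerRates.wide 0
  rw [mul_le_mul_iff_of_pos_left hY, le_div_iff₀ ha]
  rw [le_div_iff₀ (by norm_num : (0 : ℝ) < 256)] at hκ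
  linarith

/-- The winding number `m = ⌈1/(64a)⌉` of the core loop. [folklore] -/
def windings (a : ℝ) : ℕ := ⌈1 / (64 * a)⌉₊

/-- `0 < m`. [folklore] -/
theorem windings_pos (ha : 0 < a) : 0 < windings a :=
  Nat.ceil_pos.2 (by positivity)

/-- `1/64 ≤ a m`. [folklore] -/
theorem le_mul_windings (ha : 0 < a) : 1 / 64 ≤ a * windings a := by
  have h := Nat.le_ceil (1 / (64 * a))
  rw [windings]
  rw [div_le_iff₀ (by positivity)] at h
  linarith

/-- `a m ≤ 1/64 + a`. [folklore] -/
theorem mul_windings_le (ha : 0 < a) : a * windings a ≤ 1 / 64 + a := by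
  have h := (Nat.ceil_lt_add_one (by positivity : (0 : ℝ) ≤ 1 / (64 * a))).le
  rw [windings]
  have h' : a * (⌈1 / (64 * a)⌉₊ : ℝ) ≤ a * (1 / (64 * a) + 1) := mul_le_mul_of_nonneg_left h ha.le
  calc a * (⌈1 / (64 * a)⌉₊ : ℝ) ≤ a * (1 / (64 * a) + 1) := h'
    _ = 1 / 64 + a := by field_simp

/-- **The core loop** of the tiny profile. [folklore] -/
theorem core_tinyProfile (ha : 0 < a) (h5 : a ≤ 5 / 256) :
    ∃ (x : EuclideanSpace ℝ (Fin 3)) (γ : ℝ → EuclideanSpace ℝ (Fin 3)),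
      ‖x‖ ≤ 2 * a ∧ ContDiff ℝ 1 γ ∧ γ 0 = γ 1 ∧
        (∀ s ∈ Icc (0 : ℝ) 1, γ s ∈ closedBall x (1 / TowerRates.wide.N 0)) ∧
        (∀ s ∈ Icc (0 : ℝ) 1, ‖deriv γ s‖ ≤ 8 * Real.pi / TowerRates.wide.N 0) ∧
        TowerRates.wide.N 0 ^ (TowerRates.wide.β - 2) ≤ circulation (tinyProfile a) γ := by
  have hm := windings_pos ha
  have hm1 := le_mul_windings ha
  have hm2 := mul_windings_le ha
  refine ⟨(a * lc) • e₁, tinyLoop a (windings a), ?_, contDiff_tinyLoop _ _, tinyLoop_zero_eq_one _ _,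
    fun s _ => ?_, fun s _ => ?_, ?_⟩
  · rw [norm_center ha.le, lc]; linarith
  · rw [mem_closedBall, dist_eq_norm, norm_tinyLoop_sub_center ha.le, Host.wide_N_zero, lr]
    linarith
  · rw [deriv_tinyLoop, norm_tinyLoopVel ha.le, Host.wide_N_zero, lr]
    have hπ := Real.pi_pos
    have : 2 * π * (windings a : ℝ) * (a * (1 / 5)) = (2 * π / 5) * (a * windings a) := by ring
    rw [this, div_eq_mul_inv (8 * π)]
    nlinarith
  · rw [Host.wide_rpow_β_sub_two, Host.wide_N_zero]
    have hc := circulation_tinyBlob_tinyLoop_ge ha hm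
    have hY := TowerRates.Y_pos TowerRates.wide 0
    have hU : tinyProfile a = fun y => TowerRates.wide.Y 0 • tinyBlob a y := rfl
    rw [hU, circulation_const_smul, div_eq_mul_one_div]
    exact mul_le_mul_of_nonneg_left (by linarith) hY.le

/-- **THE WEAK SLOT**: `Germ.LevelZeroDataWeak U_a (2a)` for small `a`. [folklore] -/
theorem levelZeroDataWeak (ha : 0 < a) (h5 : a ≤ 5 / 256) (hκ : a ≤ strainConst / 256) :
    Germ.LevelZeroDataWeak (tinyProfile a) (2 * a) where
  smooth := contDiff_tinyProfile a
  support := tsupport_tinyProfile_subset ha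
  divFree := isDivFree_tinyProfile ha.ne'
  ceiling := norm_tinyProfile_le ha.ne'
  floor := ⟨0, by simp [ha.le], (norm_tinyProfile_zero a).ge⟩
  strain := ⟨a • strainPt, by
    rw [norm_smul, Real.norm_eq_abs, abs_of_pos ha]
    nlinarith [norm_strainPt_le], strain_tinyProfile ha hκ⟩
  core := core_tinyProfile ha h5
  anchor := anchor_tinyProfile ha

/-! ## §3 The `L³` size and the conclusion -/

/-- The unit-ball volume as a real number. [folklore] -/
def unitBallVol : ℝ := (volume (closedBall (0 : EuclideanSpace ℝ (Fin 3)) 1)).toReal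

/-- `volume B̄(0,1) = ofReal unitBallVol`. [folklore] -/
theorem volume_closedBall_one :
    volume (closedBall (0 : EuclideanSpace ℝ (Fin 3)) 1) = ENNReal.ofReal unitBallVol := by
  rw [unitBallVol, ENNReal.ofReal_toReal measure_closedBall_lt_top.ne]

/-- `0 ≤ unitBallVol`. [folklore] -/
theorem unitBallVol_nonneg : 0 ≤ unitBallVol := ENNReal.toReal_nonneg

/-- **The `L³` norm of the tiny profile**: `‖U_a‖₃ ≤ (8a³|B̄₁|)^{1/3} Y₀`. [folklore] -/
theorem eLpNorm_tinyProfile_le (ha : 0 < a) :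
    eLpNorm (tinyProfile a) 3 volume ≤
      ENNReal.ofReal ((8 * a ^ 3 * unitBallVol) ^ (3 : ℝ)⁻¹ * TowerRates.wide.Y 0) := by
  have hsupp : support (tinyProfile a) ⊆ closedBall (0 : EuclideanSpace ℝ (Fin 3)) (2 * a) :=
    (subset_tsupport _).trans (tsupport_tinyProfile_subset ha)
  rw [← eLpNorm_restrict_eq_of_support_subset hsupp]
  have hb : ∀ᵐ y ∂(volume.restrict (closedBall (0 : EuclideanSpace ℝ (Fin 3)) (2 * a))),
      ‖tinyProfile a y‖ ≤ TowerRates.wide.Y 0 :=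
    Filter.Eventually.of_forall fun y => norm_tinyProfile_le ha.ne' y
  refine (eLpNorm_le_of_ae_bound hb).trans (le_of_eq ?_)
  rw [Measure.restrict_apply_univ, Measure.addHaar_closedBall' volume _ (by positivity),
    finrank_euclideanSpace, Fintype.card_fin, volume_closedBall_one,
    ← ENNReal.ofReal_mul (by positivity), ENNReal.toReal_ofNat,
    ENNReal.ofReal_rpow_of_nonneg (by have := unitBallVol_nonneg; positivity) (by norm_num),
    ← ENNReal.ofReal_mul (by have := unitBallVol_nonneg; positivity)]
  congr 1
  ring_nf

/-- The `L³` norm is below `δ` once `a ≤ 1` and `8 a (|B̄₁| + 1) Y₀³ ≤ δ³`. [folklore] -/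
theorem eLpNorm_tinyProfile_le_of_small (ha : 0 < a) (ha1 : a ≤ 1) {δ : ℝ} (hδ : 0 < δ)
    (hsmall : 8 * a * (unitBallVol + 1) * TowerRates.wide.Y 0 ^ 3 ≤ δ ^ 3) :
    eLpNorm (tinyProfile a) 3 volume ≤ ENNReal.ofReal δ := by
  refine (eLpNorm_tinyProfile_le ha).trans (ENNReal.ofReal_le_ofReal ?_)
  have hY := TowerRates.Y_pos TowerRates.wide 0
  have hv := unitBallVol_nonneg
  have h3 : a ^ 3 ≤ a :=
    calc a ^ 3 = a * a ^ 2 := by ring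
      _ ≤ a * 1 := mul_le_mul_of_nonneg_left (by nlinarith) ha.le
      _ = a := mul_one a
  have hle : 8 * a ^ 3 * unitBallVol ≤ (δ / TowerRates.wide.Y 0) ^ 3 := by
    rw [div_pow, le_div_iff₀ (by positivity)]
    calc 8 * a ^ 3 * unitBallVol * TowerRates.wide.Y 0 ^ 3
        ≤ 8 * a * unitBallVol * TowerRates.wide.Y 0 ^ 3 := by gcongr
      _ ≤ 8 * a * (unitBallVol + 1) * TowerRates.wide.Y 0 ^ 3 := by gcongr; linarith
      _ ≤ δ ^ 3 := hsmall
  have hroot : (8 * a ^ 3 * unitBallVol) ^ (3 : ℝ)⁻¹ ≤ δ / TowerRates.wide.Y 0 := by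
    calc (8 * a ^ 3 * unitBallVol) ^ (3 : ℝ)⁻¹ ≤ ((δ / TowerRates.wide.Y 0) ^ 3) ^ (3 : ℝ)⁻¹ :=
          Real.rpow_le_rpow (by positivity) hle (by norm_num)
      _ = δ / TowerRates.wide.Y 0 := by
          have h := Real.pow_rpow_inv_natCast (n := 3) (by positivity : 0 ≤ δ / TowerRates.wide.Y 0)
            (by norm_num)
          rw [show ((3 : ℕ) : ℝ) = (3 : ℝ) by norm_cast] at h
          exact h
  calc (8 * a ^ 3 * unitBallVol) ^ (3 : ℝ)⁻¹ * TowerRates.wide.Y 0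
      ≤ δ / TowerRates.wide.Y 0 * TowerRates.wide.Y 0 := mul_le_mul_of_nonneg_right hroot hY.le
    _ = δ := by field_simp

/-- **`TinyAnchoredHosts` HOLDS**: for every `δ > 0` a pinned, rigid, quiet, globally anchored
level-`0` host of radius `≤ δ` with compactly supported datum of `L³` norm `≤ δ`. [folklore] -/
theorem tinyAnchoredHosts_holds : TinyAnchoredHosts := by
  intro δ hδ
  have hY := TowerRates.Y_pos TowerRates.wide 0
  have hv := unitBallVol_nonneg
  have hκ₁ := strainConst_pos
  -- the scale
  set a : ℝ := min (min (5 / 256) (strainConst / 256))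
    (min (δ / 2) (δ ^ 3 / (8 * (unitBallVol + 1) * TowerRates.wide.Y 0 ^ 3))) with ha_def
  have ha : 0 < a := by
    rw [ha_def]
    refine lt_min (lt_min (by norm_num) (by positivity)) (lt_min (by positivity) (by positivity))
  have h5 : a ≤ 5 / 256 := (min_le_left _ _).trans (min_le_left _ _)
  have hκ : a ≤ strainConst / 256 := (min_le_left _ _).trans (min_le_right _ _)
  have hδ2 : a ≤ δ / 2 := (min_le_right _ _).trans (min_le_left _ _)
  have hδ3 : a ≤ δ ^ 3 / (8 * (unitBallVol + 1) * TowerRates.wide.Y 0 ^ 3) :=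
    (min_le_right _ _).trans (min_le_right _ _)
  have ha1 : a ≤ 1 := h5.trans (by norm_num)
  have hsmall : 8 * a * (unitBallVol + 1) * TowerRates.wide.Y 0 ^ 3 ≤ δ ^ 3 := by
    rw [le_div_iff₀ (by positivity)] at hδ3
    linarith
  have hslot := levelZeroDataWeak ha h5 hκ
  obtain ⟨S, hP, hR, hQ, hrad, s, hs⟩ := hslot.exists_host
  refine ⟨S, hP, hR, hQ, by rw [hrad]; positivity, by rw [hrad]; linarith, s, ?_, ?_⟩
  · rw [hs]; exact hasCompactSupport_tinyProfile ha
  · rw [hs]; exact eLpNorm_tinyProfile_le_of_small ha ha1 hδ hsmall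

end Summit.NavierStokesRegularity.FluidComputer.PalasekTowerClayBridge.TinyBlob

end
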